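import Literature.Probability.Percolation.LongRangeUsable
import Literature.Probability.Percolation.LongRangeEscape
import HarnessLib

/-!
# Long-range bond percolation on `ℤ`: decoupling and the one-step renormalisation inequality

Topic `Literature/Probability/Percolation`; companion of `LongRangeModel.lean` (Duminil-Copin–
Garban–Tassion, AIHP 60 (2024), §2.4, Lemma 3: "`p̄(CK) ≥ (C^{1-βθ²}/(9e)) min{p̄(K), C⁻¹}`").

## Contents (all proved)

* generic product-measure part: the fibres `fibre J U T = {𝐔 = T}` of the random index set
  `𝐔(ω) = {j ∈ J | ω ∈ U j}`, their measurability and disjointness, the partition identities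
  `measureReal_eq_sum_inter_fibre`, `sum_measureReal_fibre`, `sum_card_mul_measureReal_fibre`,
  the elementary `one_sub_pow_le_one_sub_half`, and the **decoupling bound**
  `prodBernoulli_real_biInter_compl_union_le`:
  `P(⋂_j ((U j)ᶜ ∪ X j)) ≤ 1 - (t/2) ∑_j P(U j)` when the `X j` are determined by pairwise
  disjoint finite sets `S j` with `P(X j) ≤ 1 - t`, every fibre is determined by the complement
  of `⋃_{j ∈ T} S j`, and `t |J| ≤ 1` (DGT's "`1 - p̄(CK) ≤ 𝔼[(1 - p̄(K))^{|𝐁|}] ≤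
  1 - e⁻¹ t 𝔼|𝐁|`", in finitary form with the exact conditional-independence identity);
* `disjoint_windowEdges` and the **one-step inequality** `le_real_compl_cross_mul`: for
  `C ≥ 17` large (an explicit `C^{1-s'} ≳ e^{152β'+s'}` condition) and `0 ≤ t ≤ 1/C`, if every
  block of scale `K` fails to be crossed with probability `≥ t` then so does every block of
  scale `CK` (block lemma + decoupling + usable bound, with the `≥ C/9` blocks centred at
  `c + 9Kj`, `|j| ≤ (C-5)/9`).

## References

* H. Duminil-Copin, C. Garban, V. Tassion, *Long-range models in 1D revisited*, Ann. Inst.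
  H. Poincaré Probab. Statist. 60 (2024), arXiv:2011.04642: §2.4 (Thm. 1(ii), Lemma 3).
-/

noncomputable section

namespace Literature.Probability.Percolation

open MeasureTheory SimpleGraph Literature.Probability.LatticeModels
open scoped ENNReal

/-! ### Decoupling over a random set of usable blocks (generic product-measure form) -/

section Partition

variable {ι κ : Type*}

/-- The fibre `{𝐔 = T}` of the random set of indices `𝐔(ω) = {j ∈ J | ω ∈ U j}`. [folklore] -/
def fibre (J : Finset κ) (U : κ → Set (Set ι)) (T : Finset κ) : Set (Set ι) :=
  {ω | ∀ j ∈ J, ω ∈ U j ↔ j ∈ T}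

/-- Fibres are measurable. [folklore] -/
theorem measurableSet_fibre {J : Finset κ} {U : κ → Set (Set ι)}
    (hUm : ∀ j ∈ J, MeasurableSet (U j)) (T : Finset κ) : MeasurableSet (fibre J U T) := by
  have h : fibre J U T = ⋂ j ∈ J, {ω | ω ∈ U j ↔ j ∈ T} := by
    ext ω; simp [fibre]
  rw [h]
  refine Finset.measurableSet_biInter _ fun j hj => ?_
  by_cases hjT : j ∈ T
  · simp only [hjT, iff_true]; exact hUm j hj
  · simp only [hjT, iff_false]; exact (hUm j hj).compl

/-- Distinct subsets of `J` have disjoint fibres. [folklore] -/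
theorem pairwiseDisjoint_fibre (J : Finset κ) (U : κ → Set (Set ι)) :
    (↑J.powerset : Set (Finset κ)).PairwiseDisjoint (fibre J U) := by
  intro T hT T' hT' hne
  rw [Function.onFun, Set.disjoint_left]
  intro ω h1 h2
  refine hne (Finset.ext fun j => ⟨fun hj => ?_, fun hj => ?_⟩)
  · have hjJ := Finset.mem_powerset.1 (Finset.mem_coe.1 hT) hj
    exact (h2 j hjJ).1 ((h1 j hjJ).2 hj)
  · have hjJ := Finset.mem_powerset.1 (Finset.mem_coe.1 hT') hj
    exact (h1 j hjJ).1 ((h2 j hjJ).2 hj)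

/-- **Partition by fibres**: `P(A) = ∑_{T ⊆ J} P(A ∩ {𝐔 = T})`. [folklore] -/
theorem measureReal_eq_sum_inter_fibre (μ : Measure (Set ι)) [IsFiniteMeasure μ] (J : Finset κ)
    {U : κ → Set (Set ι)} (hUm : ∀ j ∈ J, MeasurableSet (U j)) {A : Set (Set ι)}
    (hAm : MeasurableSet A) :
    μ.real A = ∑ T ∈ J.powerset, μ.real (A ∩ fibre J U T) := by
  classical
  have hcover : A = ⋃ T ∈ J.powerset, (A ∩ fibre J U T) := by
    ext ω
    simp only [Set.mem_iUnion, Set.mem_inter_iff, exists_prop]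
    constructor
    · intro hω
      refine ⟨J.filter fun j => ω ∈ U j, Finset.mem_powerset.2 (Finset.filter_subset _ _), hω,
        fun j hj => ?_⟩
      simp [Finset.mem_filter, hj]
    · rintro ⟨T, -, hω, -⟩; exact hω
  conv_lhs => rw [hcover]
  rw [measureReal_biUnion_finset]
  · exact (pairwiseDisjoint_fibre J U).mono fun T => Set.inter_subset_right
  · exact fun T _ => hAm.inter (measurableSet_fibre hUm T)

/-- `∑_{T ⊆ J} P({𝐔 = T}) = 1` for a probability measure. [folklore] -/
theorem sum_measureReal_fibre (μ : Measure (Set ι)) [IsProbabilityMeasure μ] (J : Finset κ)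
    {U : κ → Set (Set ι)} (hUm : ∀ j ∈ J, MeasurableSet (U j)) :
    ∑ T ∈ J.powerset, μ.real (fibre J U T) = 1 := by
  have h := measureReal_eq_sum_inter_fibre μ J hUm MeasurableSet.univ
  simp only [Set.univ_inter, probReal_univ] at h
  exact h.symm

/-- `∑_{T ⊆ J} |T| P({𝐔 = T}) = ∑_{j ∈ J} P(U j)` (both count `E|𝐔|`). [folklore] -/
theorem sum_card_mul_measureReal_fibre (μ : Measure (Set ι)) [IsProbabilityMeasure μ]
    (J : Finset κ) {U : κ → Set (Set ι)} (hUm : ∀ j ∈ J, MeasurableSet (U j)) :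
    ∑ T ∈ J.powerset, (T.card : ℝ) * μ.real (fibre J U T) = ∑ j ∈ J, μ.real (U j) := by
  classical
  -- `P(U j) = ∑_{T ∋ j} P({𝐔 = T})`
  have hU : ∀ j ∈ J, μ.real (U j) =
      ∑ T ∈ J.powerset, if j ∈ T then μ.real (fibre J U T) else 0 := by
    intro j hj
    rw [measureReal_eq_sum_inter_fibre μ J hUm (hUm j hj)]
    refine Finset.sum_congr rfl fun T _ => ?_
    split_ifs with hjT
    · congr 1
      ext ω
      exact ⟨fun h => h.2, fun h => ⟨(h j hj).2 hjT, h⟩⟩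
    · have : U j ∩ fibre J U T = ∅ := by
        ext ω
        simp only [Set.mem_inter_iff, Set.mem_empty_iff_false, iff_false, not_and]
        exact fun hω hf => hjT ((hf j hj).1 hω)
      rw [this, measureReal_empty]
  rw [Finset.sum_congr rfl hU, Finset.sum_comm]
  refine Finset.sum_congr rfl fun T hT => ?_
  rw [← Finset.sum_filter, Finset.sum_const, nsmul_eq_mul]
  congr 2
  rw [Finset.filter_mem_eq_inter, Finset.inter_eq_right.2 (Finset.mem_powerset.1 hT)]

/-- `(1 - t)^n ≤ 1 - n t / 2` for `0 ≤ t` and `n t ≤ 1` (via `(1-t)^n (1 + nt) ≤ (1 - t²)^n ≤ 1`).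
[folklore] -/
theorem one_sub_pow_le_one_sub_half {t : ℝ} (ht0 : 0 ≤ t) {n : ℕ} (hn : (n : ℝ) * t ≤ 1) :
    (1 - t) ^ n ≤ 1 - (n : ℝ) * t / 2 := by
  rcases Nat.eq_zero_or_pos n with rfl | hnpos
  · simp
  have ht1 : t ≤ 1 := by
    have : (1 : ℝ) ≤ n := by exact_mod_cast hnpos
    nlinarith
  have h1 : 1 + (n : ℝ) * t ≤ (1 + t) ^ n := one_add_mul_le_pow (by linarith) n
  have h2 : (1 - t) ^ n * (1 + t) ^ n ≤ 1 := by
    rw [← mul_pow]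
    exact pow_le_one₀ (by nlinarith) (by nlinarith)
  have h0 : 0 ≤ (1 - t) ^ n := pow_nonneg (by linarith) n
  have h3 : (1 - t) ^ n * (1 + (n : ℝ) * t) ≤ 1 := le_trans (mul_le_mul_of_nonneg_left h1 h0) h2
  have hv0 : 0 ≤ (n : ℝ) * t := by positivity
  nlinarith

/-- **Decoupling bound** (the finitary core of DGT20, proof of Lemma 3:
`1 - p̄(CK) ≤ 𝔼[(1 - p̄(K))^{|𝐁|}] ≤ 1 - e^{-1} t 𝔼|𝐁|`). Let `X j` (`j ∈ J`) be events
determined by pairwise disjoint finite coordinate sets `S j`, with `P(X j) ≤ 1 - t`, and let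
`U j` be events such that every fibre `{𝐔 = T}` of `𝐔(ω) = {j | ω ∈ U j}` is determined by
the complement of `⋃_{j ∈ T} S j`. If `t |J| ≤ 1` then
`P(⋂_j ((U j)ᶜ ∪ X j)) ≤ 1 - (t/2) ∑_j P(U j)`.
[cite: DuminilcopinGarbanTassion2024, §2.4 (proof of Lemma 3)] -/
theorem prodBernoulli_real_biInter_compl_union_le (p : ι → unitInterval) (J : Finset κ)
    (S : κ → Finset ι) (hS : (J : Set κ).PairwiseDisjoint S) (U X : κ → Set (Set ι))
    (hX : ∀ j ∈ J, DeterminedBy (X j) (↑(S j) : Set ι)) (hXm : ∀ j ∈ J, MeasurableSet (X j))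
    (hUm : ∀ j ∈ J, MeasurableSet (U j))
    (hUdet : ∀ T ∈ J.powerset, DeterminedBy (fibre J U T) (⋃ j ∈ T, (↑(S j) : Set ι))ᶜ)
    {t : ℝ} (ht0 : 0 ≤ t) (htX : ∀ j ∈ J, (prodBernoulli p).real (X j) ≤ 1 - t)
    (htJ : t * J.card ≤ 1) :
    (prodBernoulli p).real (⋂ j ∈ J, ((U j)ᶜ ∪ X j)) ≤
      1 - t / 2 * ∑ j ∈ J, (prodBernoulli p).real (U j) := by
  classical
  set μ := prodBernoulli p with hμ
  have hAm : MeasurableSet (⋂ j ∈ J, ((U j)ᶜ ∪ X j)) :=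
    Finset.measurableSet_biInter _ fun j hj => (hUm j hj).compl.union (hXm j hj)
  rw [measureReal_eq_sum_inter_fibre μ J hUm hAm, ← sum_card_mul_measureReal_fibre μ J hUm,
    Finset.mul_sum, ← sum_measureReal_fibre μ J hUm (U := U), ← Finset.sum_sub_distrib]
  refine Finset.sum_le_sum fun T hT => ?_
  have hTJ : T ⊆ J := Finset.mem_powerset.1 hT
  -- `A ∩ {𝐔 = T} ⊆ {𝐔 = T} ∩ ⋂_{j ∈ T} X j`
  have hsub : (⋂ j ∈ J, ((U j)ᶜ ∪ X j)) ∩ fibre J U T ⊆ fibre J U T ∩ ⋂ j ∈ T, X j := by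
    rintro ω ⟨hA, hF⟩
    refine ⟨hF, Set.mem_iInter₂.2 fun j hj => ?_⟩
    have hjJ := hTJ hj
    rcases Set.mem_iInter₂.1 hA j hjJ with h | h
    · exact absurd ((hF j hjJ).2 hj) h
    · exact h
  refine le_trans (measureReal_mono hsub) ?_
  rw [prodBernoulli_real_inter_biInter_of_determinedBy p T S (hS.subset (by exact_mod_cast hTJ))
    (fun j hj => hX j (hTJ hj)) (fun j hj => hXm j (hTJ hj)) (hUdet T hT)
    (measurableSet_fibre hUm T)]
  -- `∏_{j ∈ T} P(X j) ≤ (1 - t)^{|T|} ≤ 1 - |T| t / 2`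
  have hprod : ∏ j ∈ T, μ.real (X j) ≤ (1 - t) ^ T.card := by
    rw [← Finset.prod_const]
    exact Finset.prod_le_prod (fun j _ => measureReal_nonneg) fun j hj => htX j (hTJ hj)
  have hTt : (T.card : ℝ) * t ≤ 1 := by
    have : (T.card : ℝ) ≤ J.card := by exact_mod_cast Finset.card_le_card hTJ
    nlinarith
  have hpow := one_sub_pow_le_one_sub_half ht0 hTt
  have hF0 : 0 ≤ μ.real (fibre J U T) := measureReal_nonneg
  calc μ.real (fibre J U T) * ∏ j ∈ T, μ.real (X j)
      ≤ μ.real (fibre J U T) * (1 - (T.card : ℝ) * t / 2) :=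
        mul_le_mul_of_nonneg_left (hprod.trans hpow) hF0
    _ = μ.real (fibre J U T) - t / 2 * ((T.card : ℝ) * μ.real (fibre J U T)) := by ring

end Partition

/-! ### The one-step renormalisation inequality (DGT20, Lemma 3) -/

/-- Windows of blocks whose centres differ by more than `8K` have disjoint edge sets. [folklore] -/
theorem disjoint_windowEdges {K : ℕ} {c c' : ℤ} (h : (8 * K : ℤ) < c' - c ∨ (8 * K : ℤ) < c - c') :
    Disjoint (windowEdges K c) (windowEdges K c') := by
  rw [Set.disjoint_left]
  intro e he he'
  induction e using Sym2.ind with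
  | h x y =>
    rw [mk_mem_windowEdges_iff] at he he'
    omega

/-- **One renormalisation step** (DGT20, Lemma 3: "`p̄(CK) ≥ (C^{1-βθ²}/(9e)) min{p̄(K), C⁻¹}`",
in the form used in the proof of Thm. 1(ii): for `C` large the prefactor is `≥ 1`). Fix the scale
`K ≥ 1`, `R ≤ K`, the decay `K_d ≤ β'/d²` beyond `K` with `(K+1)² ≥ 2β'`, the exit bound
`P(0 exits its R-ball) ≤ θ₁`, the smallness `θ₂² β'/K² ≤ δ/(1+δ)`, an exponent `s'` with
`(1+δ) β' θ₂² ≤ s'`, and `C ≥ 17` with `C e^{-152β'} e^{-s'} C^{-s'} ≥ 18`. If `0 ≤ t ≤ 1/C`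
and every block of scale `K` fails to be crossed with probability `≥ t`, then so does every
block of scale `CK`. Proof: block lemma + decoupling bound + usable-window bound, with the
`2⌊(C-5)/9⌋ + 1 ≥ C/9` blocks centred at `c + 9Kj`.
[cite: DuminilcopinGarbanTassion2024, §2.4 (Lemma 3)] -/
theorem le_real_compl_cross_mul {K : ℕ → unitInterval} {β' θ₁ δ s' t : ℝ} (hβ : 0 < β')
    (hδ : 0 < δ) {k C R : ℕ} (hk : 1 ≤ k) (hC : 17 ≤ C) (hR : R ≤ k)
    (hdecay : ∀ n : ℕ, k < n → (K n : ℝ) ≤ β' / (n : ℝ) ^ 2) (hk2 : 2 * β' ≤ ((k : ℝ) + 1) ^ 2)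
    (hθ : (lrMeasure K).real {ω | exits R ω 0} ≤ θ₁)
    (hsmall : bridgeTheta β' θ₁ k R * (β' / (k : ℝ) ^ 2) ≤ δ / (1 + δ))
    (hs' : (1 + δ) * (β' * bridgeTheta β' θ₁ k R) ≤ s')
    (hbig : 18 ≤ (C : ℝ) * (Real.exp (-(152 * β')) * (Real.exp (-s') *
      Real.exp (-(s' * Real.log C)))))
    (ht0 : 0 ≤ t) (htC : t ≤ 1 / C) (ht : ∀ c : ℤ, t ≤ (lrMeasure K).real (cross k c)ᶜ)
    (c : ℤ) : t ≤ (lrMeasure K).real (cross (C * k) c)ᶜ := by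
  classical
  set μ := lrMeasure K with hμ
  set L := C * k with hL
  set J₀ : ℕ := (C - 5) / 9 with hJ₀
  set J : Finset ℤ := Finset.Icc (-(J₀ : ℤ)) J₀ with hJ
  set ctr : ℤ → ℤ := fun j => c + 9 * k * j with hctr
  have hC2 : 2 ≤ C := le_trans (by norm_num) hC
  have hC1 : (1 : ℝ) ≤ C := by exact_mod_cast le_trans (by norm_num) hC
  have hJ₀C : 9 * J₀ + 5 ≤ C := by omega
  -- the block lemma applies to every block `j ∈ J`
  have hblock : ∀ j ∈ J, cross L c ⊆ (usable k L R (ctr j))ᶜ ∪ cross k (ctr j) := by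
    intro j hj
    rw [hJ, Finset.mem_Icc] at hj
    have h9 : (9 * k * |j| : ℤ) ≤ (C : ℤ) * k - 5 * k := by
      have : (|j| : ℤ) ≤ J₀ := abs_le.2 hj
      have hk0 : (0 : ℤ) ≤ k := by positivity
      have : (9 * J₀ + 5 : ℤ) ≤ C := by exact_mod_cast hJ₀C
      nlinarith
    have hc₁ : c - C * k + 5 * k ≤ ctr j := by
      simp only [hctr]; cases abs_cases j <;> nlinarith
    have hc₂ : ctr j + 5 * k ≤ c + C * k := by
      simp only [hctr]; cases abs_cases j <;> nlinarith
    intro ω hω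
    have h := cross_subset_touched_union_jumpBridged_union_cross (R := R) hk hc₁ hc₂ hω
    simp only [usable, Set.compl_inter, compl_compl, Set.mem_union] at h ⊢
    tauto
  -- hence `P(cross L c) ≤ P(⋂_j (U_jᶜ ∪ X_j))`
  have hle1 : μ.real (cross L c) ≤ μ.real (⋂ j ∈ J, ((usable k L R (ctr j))ᶜ ∪ cross k (ctr j))) :=
    measureReal_mono fun ω hω => Set.mem_iInter₂.2 fun j hj => hblock j hj hω
  -- the decoupling bound
  set S : ℤ → Finset (Sym2 ℤ) := fun j => (windowEdges_finite k (ctr j)).toFinset with hSdef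
  have hScoe : ∀ j, (↑(S j) : Set (Sym2 ℤ)) = windowEdges k (ctr j) := fun j =>
    (windowEdges_finite k (ctr j)).coe_toFinset
  have hSdisj : (J : Set ℤ).PairwiseDisjoint S := by
    intro i _ j _ hij
    rw [Function.onFun, ← Finset.disjoint_coe, hScoe, hScoe]
    refine disjoint_windowEdges ?_
    simp only [hctr]
    have hk1 : (1 : ℤ) ≤ k := by exact_mod_cast hk
    rcases lt_or_gt_of_ne hij with h | h
    · left; nlinarith
    · right; nlinarith
  have hUdet : ∀ T ∈ J.powerset, DeterminedBy (fibre J (fun j => usable k L R (ctr j)) T)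
      (⋃ j ∈ T, (↑(S j) : Set (Sym2 ℤ)))ᶜ := by
    intro T hT
    rw [determinedBy_iff]
    -- symmetric transfer
    suffices key : ∀ ω ω' : BondConfig ℤ, ω ∩ (⋃ j ∈ T, (↑(S j) : Set (Sym2 ℤ)))ᶜ =
        ω' ∩ (⋃ j ∈ T, (↑(S j) : Set (Sym2 ℤ)))ᶜ →
        ω ∈ fibre J (fun j => usable k L R (ctr j)) T →
        ω' ∈ fibre J (fun j => usable k L R (ctr j)) T from
      fun ω ω' h => ⟨key ω ω' h, key ω' ω h.symm⟩
    intro ω ω' h hω j hj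
    -- agreement off the union of the windows of `T`
    have hagree : ∀ f : Sym2 ℤ, f ∉ (⋃ j ∈ T, windowEdges k (ctr j)) → (f ∈ ω ↔ f ∈ ω') := by
      intro f hf
      have hf' : f ∈ (⋃ j ∈ T, (↑(S j) : Set (Sym2 ℤ)))ᶜ := by
        simpa only [Set.mem_compl_iff, hScoe] using hf
      have := Set.ext_iff.1 h f
      simp only [Set.mem_inter_iff] at this
      exact ⟨fun h1 => (this.1 ⟨h1, hf'⟩).1, fun h1 => (this.2 ⟨h1, hf'⟩).1⟩
    have hlong : ∀ f : Sym2 ℤ, k < edgeLen f → (f ∈ ω ↔ f ∈ ω') := by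
      intro f hf
      refine hagree f fun hf' => ?_
      obtain ⟨j, -, hfj⟩ := Set.mem_iUnion₂.1 hf'
      exact absurd hfj.1 (not_le.2 hf)
    have hU : ∀ c'' ∈ (↑T : Set ℤ).image ctr, ω ∉ touched k L R c'' := by
      rintro c'' ⟨i, hi, rfl⟩
      have hiJ : i ∈ J := Finset.mem_powerset.1 hT (Finset.mem_coe.1 hi)
      have := ((hω i hiJ).2 (Finset.mem_coe.1 hi)).1
      exact this
    have hS' : (⋃ j ∈ T, windowEdges k (ctr j)) ⊆ ⋃ c'' ∈ (↑T : Set ℤ).image ctr,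
        windowEdges k c'' := by
      intro f hf
      obtain ⟨j, hj, hfj⟩ := Set.mem_iUnion₂.1 hf
      exact Set.mem_biUnion ⟨j, hj, rfl⟩ hfj
    have ht' := touched_iff_of_agree (K := k) (L := L) (R := R) (c := ctr j) hlong
    have hj' := jumpBridged_iff_of_agree hS' hagree hU (ctr j)
    rw [← hω j hj]
    simp only [usable, Set.mem_inter_iff, Set.mem_compl_iff, ht', hj']
  have hXle : ∀ j ∈ J, μ.real (cross k (ctr j)) ≤ 1 - t := by
    intro j _
    have := ht (ctr j)
    rw [probReal_compl_eq_one_sub (measurableSet_cross k _)] at this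
    linarith
  have hcardJ : (J.card : ℝ) = 2 * J₀ + 1 := by
    rw [hJ, Int.card_Icc]
    have : ((J₀ : ℤ) + 1 - -(J₀ : ℤ)).toNat = 2 * J₀ + 1 := by omega
    rw [this]; push_cast; ring
  have hcardJ_le : (J.card : ℝ) ≤ C := by
    rw [hcardJ]
    have : (2 * J₀ + 1 : ℕ) ≤ C := by omega
    exact_mod_cast this
  have hcardJ_ge : (C : ℝ) / 9 ≤ J.card := by
    rw [hcardJ]
    have h1 : 9 * J₀ + 13 ≥ C := by omega
    have h2 : ((9 * J₀ + 13 : ℕ) : ℝ) ≥ C := by exact_mod_cast h1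
    have h3 : (17 : ℝ) ≤ C := by exact_mod_cast hC
    push_cast at h2
    linarith
  have htJ : t * J.card ≤ 1 := by
    have hCpos : (0 : ℝ) < C := by linarith
    calc t * J.card ≤ (1 / C) * C := mul_le_mul htC hcardJ_le (Nat.cast_nonneg _) (by positivity)
      _ = 1 := by field_simp
  have hdec := prodBernoulli_real_biInter_compl_union_le (edgeProb K) J S hSdisj
    (fun j => usable k L R (ctr j)) (fun j => cross k (ctr j))
    (fun j _ => by rw [hScoe]; exact determinedBy_cross k (ctr j))
    (fun j _ => measurableSet_cross k (ctr j)) (fun j _ => measurableSet_usable k L R (ctr j))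
    hUdet ht0 hXle htJ
  -- the usable bound, summed over the blocks
  have hU1 : ∀ j ∈ J, Real.exp (-(152 * β')) * (Real.exp (-s') * Real.exp (-(s' * Real.log C))) ≤
      μ.real (usable k L R (ctr j)) := by
    intro j _
    refine le_trans ?_ (exp_le_real_usable hβ hδ hk hC2 hR hdecay hk2 hθ hsmall (ctr j))
    refine mul_le_mul_of_nonneg_left ?_ (Real.exp_pos _).le
    have hlogC : 0 ≤ Real.log C := Real.log_nonneg hC1
    refine mul_le_mul (Real.exp_le_exp.2 (by linarith)) (Real.exp_le_exp.2 ?_) (Real.exp_pos _).le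
      (Real.exp_pos _).le
    nlinarith
  have hsumU : (C : ℝ) / 9 * (Real.exp (-(152 * β')) * (Real.exp (-s') *
      Real.exp (-(s' * Real.log C)))) ≤ ∑ j ∈ J, μ.real (usable k L R (ctr j)) := by
    refine le_trans (mul_le_mul_of_nonneg_right hcardJ_ge (by positivity)) ?_
    rw [← nsmul_eq_mul, ← Finset.sum_const]
    exact Finset.sum_le_sum hU1
  -- assemble: `P(cross L c) ≤ 1 - t`
  have hdec' : μ.real (⋂ j ∈ J, ((usable k L R (ctr j))ᶜ ∪ cross k (ctr j))) ≤
      1 - t / 2 * ∑ j ∈ J, μ.real (usable k L R (ctr j)) := hdec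
  have hX2 : 2 ≤ (C : ℝ) / 9 * (Real.exp (-(152 * β')) * (Real.exp (-s') *
      Real.exp (-(s' * Real.log C)))) := by linarith
  have h18 : t ≤ t / 2 * ((C : ℝ) / 9 * (Real.exp (-(152 * β')) * (Real.exp (-s') *
      Real.exp (-(s' * Real.log C))))) := by nlinarith [mul_nonneg ht0 (sub_nonneg.2 hX2)]
  have hmul := mul_le_mul_of_nonneg_left hsumU (by positivity : 0 ≤ t / 2)
  have hfinal : μ.real (cross L c) ≤ 1 - t := by linarith
  rw [probReal_compl_eq_one_sub (measurableSet_cross L c)]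
  linarith

end Literature.Probability.Percolation
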